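import Mathlib.Data.Real.Basic
import Mathlib.Tactic.Linarith
import Mathlib.Tactic.Positivity
import Mathlib.Tactic.Ring
import HarnessLib

/-!
# QUANT lane R8, T-DEC: the TWO-HEAVY-ROWS INEQUALITY of LEMMA W's two-column criterion — a Handelman certificate found by linear programming
# (kit j297124), replayed by `linarith` (arm-1 gen 59, architect)

builds on p205010 (kernel theorem, internal audit signed; external expert review pending)

Support file (`--supports stmt-CriticalPhenomena-4575`), QUANT lane seat prim-quant-arm-1 (gen 59); memo `run/shared/lean/prim/quant/prim-quant-arm-1-g59/ARCH-G59.md`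
§0 (6).  Pure real algebra, theorems only, standard axioms, no sorries; one declaration at `maxHeartbeats 8000000` (an 81-term linear combination).

WHAT.  The cell "both lower copies of the low atom heavy for `h`" of the two-column breakpoint criterion (`…QuantGluedWindowIneq`) needs, beyond
the chord inequality `p2l`, the inequality `TwoHeavyRowsIneq` of the memo:
  `(t₀(ρ₀' − y) + t₁(ρ₁ − y))·y²·(1 + y − ρ₀) ≤ P·(y² + (1−y)ρ₀)·(1 + y − ρ₀')·(ρ₀' − y)`
for `0 ≤ y ≤ 1`, `y ≤ t₂ ≤ P`, `t₀, t₁ ≥ 0`, `t₀+t₁+t₂ = 1`, `y ≤ ρ₁ ≤ ρ₀' ≤ 1`, `ρ₀'(1+t₀) ≤ 2ρ₀`, `ρ₁(2−t₂) ≤ 2ρ₀`, `0 ≤ ρ₀ ≤ y`.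
`nlinarith` does not find it; a degree-5 Handelman certificate exists: the cleared polynomial at `P = t₂` is an exact nonnegative rational
combination of 81 products of at most five of the twelve sign conditions (LP on the compute farm, kit j297124 with typer g23's `kitlp.py`,
exact repair; explore/ and kit/thr/ in the arm-1 g59 folder).  `two_heavy_rows_poly` replays it; `two_heavy_rows_ineq` is the inequality
with general `P ≥ t₂`.  With it every cell of the LOW-TRIPLE regime of LEMMA W's pair condition has its real inequality in the kernel.

HONEST STATUS.  Real-algebra infrastructure; `GluedLemmaW` (flow form), `GluedDominatedMass`, the band, `SiblingStep`, `FarTreeRow` OPEN; RATE class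
(log\*) / honest sentence of `run/shared/lean/prim/quant/README.md` unchanged.  [this work].  Handelman / Positivstellensatz certificates are classical;
nothing here is cited as a published result.  The gluing rows served [cite: KozmaNitzan2024, Conjecture 3 (p. 15)]; product measure
[cite: Grimmett1999, §1.3 p. 10].
-/

namespace Summit.CriticalPhenomena.PercolationContinuityZ3.Theorems
namespace Quant
namespace LawDec
namespace GluedWindow

set_option maxHeartbeats 8000000 in
/-- **the two-heavy-rows inequality, cleared form at `P = t₂`**: Handelman certificate (81 products of at most 5 of the sign
conditions, exact rational weights; found by linear programming on the compute farm, kit j297124, typer g23's `kitlp.py`), replayed by `linarith`;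
the kernel checks the identity. [this work] -/
theorem two_heavy_rows_poly (y t0 t2 ρ₀ A R : ℝ) (g0 : 0 ≤ y) (g1 : 0 ≤ 1 - y) (g2 : 0 ≤ t2 - y) (g3 : 0 ≤ t0) (g4 : 0 ≤ 1 - t0 - t2) (g5 : 0 ≤ R - y) (g6 : 0 ≤ A - R) (g7 : 0 ≤ 1 - A) (g8 : 0 ≤ 2 * ρ₀ - A * (1 + t0)) (g9 : 0 ≤ 2 * ρ₀ - R * (2 - t2)) (g10 : 0 ≤ y - ρ₀) (g11 : 0 ≤ ρ₀) :
    0 ≤ t2 * (y ^ 2 + (1 - y) * ρ₀) * (1 + y - A) * (A - y) - (t0 * (A - y) + (1 - t0 - t2) * (R - y)) * y ^ 2 * (1 + y - ρ₀) := by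
  linarith [mul_nonneg (mul_nonneg (mul_nonneg (mul_nonneg g0 g0) g0) g0) g5,
    mul_nonneg (mul_nonneg (mul_nonneg (mul_nonneg g0 g0) g0) g2) g5,
    mul_nonneg (mul_nonneg (mul_nonneg (mul_nonneg g0 g0) g0) g2) g6,
    mul_nonneg (mul_nonneg (mul_nonneg (mul_nonneg g0 g0) g0) g4) g6,
    mul_nonneg (mul_nonneg (mul_nonneg g0 g0) g0) g5,
    mul_nonneg (mul_nonneg (mul_nonneg (mul_nonneg g0 g0) g0) g5) g7,
    mul_nonneg (mul_nonneg (mul_nonneg (mul_nonneg g0 g0) g0) g5) g10,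
    mul_nonneg (mul_nonneg (mul_nonneg g0 g0) g0) g6,
    mul_nonneg (mul_nonneg (mul_nonneg (mul_nonneg g0 g0) g0) g6) g6,
    mul_nonneg (mul_nonneg (mul_nonneg (mul_nonneg g0 g0) g0) g6) g7,
    mul_nonneg (mul_nonneg (mul_nonneg (mul_nonneg g0 g0) g0) g6) g10,
    mul_nonneg (mul_nonneg (mul_nonneg g0 g0) g2) g5,
    mul_nonneg (mul_nonneg (mul_nonneg (mul_nonneg g0 g0) g2) g5) g7,
    mul_nonneg (mul_nonneg (mul_nonneg (mul_nonneg g0 g0) g2) g5) g10,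
    mul_nonneg (mul_nonneg (mul_nonneg g0 g0) g2) g6,
    mul_nonneg (mul_nonneg (mul_nonneg (mul_nonneg g0 g0) g2) g6) g7,
    mul_nonneg (mul_nonneg (mul_nonneg (mul_nonneg g0 g0) g2) g6) g10,
    mul_nonneg (mul_nonneg (mul_nonneg (mul_nonneg g0 g0) g3) g5) g11,
    mul_nonneg (mul_nonneg (mul_nonneg g0 g0) g4) g6,
    mul_nonneg (mul_nonneg (mul_nonneg (mul_nonneg g0 g0) g4) g6) g10,
    mul_nonneg (mul_nonneg (mul_nonneg (mul_nonneg g0 g0) g5) g7) g10,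
    mul_nonneg (mul_nonneg (mul_nonneg g0 g0) g5) g9,
    mul_nonneg (mul_nonneg (mul_nonneg (mul_nonneg g0 g0) g6) g7) g10,
    mul_nonneg (mul_nonneg (mul_nonneg g0 g0) g6) g8,
    mul_nonneg (mul_nonneg (mul_nonneg g0 g0) g6) g9,
    mul_nonneg (mul_nonneg (mul_nonneg g0 g0) g6) g10,
    mul_nonneg (mul_nonneg (mul_nonneg (mul_nonneg g0 g1) g1) g5) g6,
    mul_nonneg (mul_nonneg (mul_nonneg (mul_nonneg g0 g1) g2) g5) g11,
    mul_nonneg (mul_nonneg (mul_nonneg (mul_nonneg g0 g1) g2) g6) g11,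
    mul_nonneg (mul_nonneg (mul_nonneg (mul_nonneg g0 g1) g5) g5) g7,
    mul_nonneg (mul_nonneg (mul_nonneg (mul_nonneg g0 g1) g5) g6) g7,
    mul_nonneg (mul_nonneg (mul_nonneg g0 g2) g3) g5,
    mul_nonneg (mul_nonneg (mul_nonneg (mul_nonneg g0 g2) g3) g6) g6,
    mul_nonneg (mul_nonneg (mul_nonneg (mul_nonneg g0 g2) g5) g7) g7,
    mul_nonneg (mul_nonneg (mul_nonneg (mul_nonneg g0 g2) g6) g7) g10,
    mul_nonneg (mul_nonneg (mul_nonneg g0 g2) g6) g8,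
    mul_nonneg (mul_nonneg (mul_nonneg g0 g3) g5) g5,
    mul_nonneg (mul_nonneg (mul_nonneg (mul_nonneg g0 g3) g5) g5) g7,
    mul_nonneg (mul_nonneg (mul_nonneg (mul_nonneg g0 g3) g5) g5) g10,
    mul_nonneg (mul_nonneg (mul_nonneg g0 g3) g5) g6,
    mul_nonneg (mul_nonneg (mul_nonneg (mul_nonneg g0 g3) g5) g6) g7,
    mul_nonneg (mul_nonneg (mul_nonneg (mul_nonneg g0 g3) g5) g6) g10,
    mul_nonneg (mul_nonneg (mul_nonneg (mul_nonneg g0 g3) g6) g6) g10,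
    mul_nonneg (mul_nonneg (mul_nonneg g0 g3) g6) g9,
    mul_nonneg (mul_nonneg (mul_nonneg g0 g4) g5) g5,
    mul_nonneg (mul_nonneg (mul_nonneg (mul_nonneg g0 g4) g5) g5) g7,
    mul_nonneg (mul_nonneg (mul_nonneg (mul_nonneg g0 g4) g5) g5) g10,
    mul_nonneg (mul_nonneg (mul_nonneg (mul_nonneg g0 g4) g5) g6) g7,
    mul_nonneg (mul_nonneg (mul_nonneg (mul_nonneg g0 g4) g5) g6) g10,
    mul_nonneg (mul_nonneg (mul_nonneg (mul_nonneg g0 g4) g6) g7) g11,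
    mul_nonneg (mul_nonneg (mul_nonneg g0 g4) g6) g10,
    mul_nonneg (mul_nonneg g0 g5) g5,
    mul_nonneg (mul_nonneg (mul_nonneg g0 g5) g5) g7,
    mul_nonneg (mul_nonneg (mul_nonneg g0 g5) g6) g7,
    mul_nonneg (mul_nonneg (mul_nonneg g0 g5) g7) g9,
    mul_nonneg (mul_nonneg (mul_nonneg g0 g5) g8) g11,
    mul_nonneg (mul_nonneg g0 g5) g9,
    mul_nonneg (mul_nonneg (mul_nonneg g0 g5) g9) g10,
    mul_nonneg (mul_nonneg (mul_nonneg g0 g6) g7) g9,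
    mul_nonneg (mul_nonneg g0 g6) g9,
    mul_nonneg (mul_nonneg (mul_nonneg (mul_nonneg g1 g1) g2) g5) g5,
    mul_nonneg (mul_nonneg (mul_nonneg (mul_nonneg g1 g1) g2) g5) g6,
    mul_nonneg (mul_nonneg (mul_nonneg (mul_nonneg g1 g1) g5) g5) g11,
    mul_nonneg (mul_nonneg (mul_nonneg (mul_nonneg g1 g2) g5) g7) g11,
    mul_nonneg (mul_nonneg (mul_nonneg (mul_nonneg g1 g2) g6) g6) g10,
    mul_nonneg (mul_nonneg (mul_nonneg (mul_nonneg g1 g3) g5) g5) g11,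
    mul_nonneg (mul_nonneg (mul_nonneg (mul_nonneg g1 g3) g5) g6) g11,
    mul_nonneg (mul_nonneg (mul_nonneg (mul_nonneg g1 g4) g5) g5) g11,
    mul_nonneg (mul_nonneg (mul_nonneg (mul_nonneg g1 g4) g5) g6) g11,
    mul_nonneg (mul_nonneg (mul_nonneg g1 g5) g6) g10,
    mul_nonneg (mul_nonneg (mul_nonneg g2 g3) g5) g5,
    mul_nonneg (mul_nonneg (mul_nonneg g2 g3) g5) g6,
    mul_nonneg (mul_nonneg (mul_nonneg g2 g5) g7) g11,
    mul_nonneg (mul_nonneg g2 g5) g8,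
    mul_nonneg (mul_nonneg g2 g5) g11,
    mul_nonneg (mul_nonneg (mul_nonneg g2 g6) g7) g11,
    mul_nonneg (mul_nonneg g2 g6) g11,
    mul_nonneg (mul_nonneg (mul_nonneg g4 g5) g5) g10,
    mul_nonneg (mul_nonneg g5 g5) g10,
    mul_nonneg (mul_nonneg g6 g9) g11,
    mul_nonneg (mul_nonneg g6 g10) g11]

/-- **THE TWO-HEAVY-ROWS INEQUALITY** (memo ARCH-G59 §0 (6)) for general `P ≥ t₂`. [this work] -/
theorem two_heavy_rows_ineq (y t0 t1 t2 P ρ₀ ρ₀' ρ₁ : ℝ) (hy0 : 0 ≤ y) (hy1 : y ≤ 1) (ht2 : y ≤ t2) (hP : t2 ≤ P)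
    (ht0 : 0 ≤ t0) (ht1 : 0 ≤ t1) (hts : t0 + t1 + t2 = 1) (hρ₁y : y ≤ ρ₁) (hρ₁ : ρ₁ ≤ ρ₀') (hρ₀'1 : ρ₀' ≤ 1)
    (hF1 : ρ₀' * (1 + t0) ≤ 2 * ρ₀) (hF2 : ρ₁ * (2 - t2) ≤ 2 * ρ₀) (hρ₀0 : 0 ≤ ρ₀) (hρ₀y : ρ₀ ≤ y) :
    (t0 * (ρ₀' - y) + t1 * (ρ₁ - y)) * y ^ 2 * (1 + y - ρ₀) ≤ P * (y ^ 2 + (1 - y) * ρ₀) * (1 + y - ρ₀') * (ρ₀' - y) := by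
  have ht1e : t1 = 1 - t0 - t2 := by linarith
  have poly := two_heavy_rows_poly y t0 t2 ρ₀ ρ₀' ρ₁ hy0 (by linarith) (by linarith) ht0 (by linarith) (by linarith) (by linarith)
    (by linarith) (by linarith) (by linarith) (by linarith) hρ₀0
  have hM : 0 ≤ (y ^ 2 + (1 - y) * ρ₀) * (1 + y - ρ₀') * (ρ₀' - y) := by
    have h1 : 0 ≤ y ^ 2 + (1 - y) * ρ₀ := by nlinarith
    have h2 : 0 ≤ 1 + y - ρ₀' := by linarith
    have h3 : 0 ≤ ρ₀' - y := by linarith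
    positivity
  have hPM := mul_le_mul_of_nonneg_right hP hM
  rw [ht1e]
  nlinarith [poly, hPM]

end GluedWindow
end LawDec
end Quant
end Summit.CriticalPhenomena.PercolationContinuityZ3.Theorems
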